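import Summits.QuantumAdvantage.QuantumAdvantage.Theorems.SosSandwichHomogeneousPBAAAddrStep

/-!
# Route `SosSandwich`, crux `PseudoBoundedAA` (stmt-QuantumAdvantage-15237) — the XOR-SQUARE device:
# `(1 + G₁G₂)/2 ∈ K_T` for ANY two `±1`-valued polynomials of total degree `≤ T` on disjoint blocks

The generator behind the refutation of `HomogeneousPBAA` (`SosSandwichHomogeneousPBAARefutation`), stated in general for
refuter / planner use: if `G₁` (on `Fin N₁`) and `G₂` (on `Fin N₂`) are `±1`-valued on the cube (`Gᵢ² = 1`) with
total degree `≤ T`, then the XOR-composition of `h₁ = (1 + G₁)/2` and `h₂ = (1 + G₂)/2`,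
`h₁ ⊕ h₂ = h₁h₂ + (1 − h₁)(1 − h₂) = (1 + G₁G₂)/2`, is PSEUDO-BOUNDED OF ORDER `T` — not `2T` as the generic product rule
(`pseudoBounded_xor`, orders add) gives — with ONE square on each side:
`(1 + G₁G₂)/2 = ((G₁ + G₂)/2)²`, `(1 − G₁G₂)/2 = ((G₁ − G₂)/2)²` on the cube. Consequently every pair of Boolean
(`±1`) functions of degree `≤ T` yields a member of `K_T` whose centred part `G₁G₂/2` inherits the Fourier LEVELS of
`G₁G₂` and whose influences are those of `G₁`, `G₂` (`influence_xor_castAdd/natAdd` with `Var[(1+G)/2] = 1/4`):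
a cheap source of `K_T`-test families (typically outside `Q_T`) for any proposed "flat class / absolute constant" rung.
[cite: KaniewskiLeeDewolf2015, Def. 7] [cite: EscuderoGutierrez2023, Thm. 1.6]
-/

set_option linter.dupNamespace false -- D-0017: single-problem summit ⇒ `QuantumAdvantage.QuantumAdvantage` by design

noncomputable section

namespace Summit.QuantumAdvantage.QuantumAdvantage.Theorems.SosSandwich

open Finset MvPolynomial Literature.Computability.QuantumComplexity

variable {N N₁ N₂ : ℕ}

/-- `h = (1 + G)/2` evaluates to `(1 + g)/2`. [folklore] -/
theorem evalBool_half_one_add (G : MvPolynomial (Fin N) ℝ) (x : Fin N → Bool) :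
    evalBool (C (1 / 2) * (1 + G)) x = 1 / 2 * (1 + evalBool G x) := by
  rw [AddrWitness.evalBool_C_mul', AddrWitness.evalBool_add', AddrWitness.evalBool_one']

/-- For a `±1`-valued `G`, `h = (1 + G)/2` has `(h − 1/2)² ≡ 1/4`, hence `Var[h] = 1/4` as soon as `E h = 1/2`.
[folklore] -/
theorem boolVariance_half_one_add {G : MvPolynomial (Fin N) ℝ} (hsq : ∀ x, evalBool G x ^ 2 = 1)
    (hm : boolAvg (evalBool (C (1 / 2) * (1 + G))) = 1 / 2) :
    boolVariance (C (1 / 2) * (1 + G)) = 1 / 4 := by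
  unfold boolVariance
  rw [hm, show (fun x => (evalBool (C (1 / 2) * (1 + G)) x - 1 / 2) ^ 2) = fun _ => (1 / 4 : ℝ) from
    funext fun x => by rw [evalBool_half_one_add]; linear_combination (1 / 4 : ℝ) * hsq x]
  exact boolAvg_const _

/-- **The XOR-square device.** For `±1`-valued `G₁, G₂` of total degree `≤ T` on disjoint blocks, the XOR-composition
`h₁ ⊕ h₂ = (1 + G₁G₂)/2` of `hᵢ = (1 + Gᵢ)/2` is pseudo-bounded of order `T` (one square each side:
`((G₁ + G₂)/2)²` and `((G₁ − G₂)/2)²`). [cite: KaniewskiLeeDewolf2015, Def. 7] -/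
theorem pseudoBounded_xor_of_sq_eq_one {T : ℕ} {G₁ : MvPolynomial (Fin N₁) ℝ} {G₂ : MvPolynomial (Fin N₂) ℝ}
    (hd₁ : G₁.totalDegree ≤ T) (hd₂ : G₂.totalDegree ≤ T)
    (h₁ : ∀ x, evalBool G₁ x ^ 2 = 1) (h₂ : ∀ y, evalBool G₂ y ^ 2 = 1) :
    PseudoBounded T
      (rename (Fin.castAdd N₂) (C (1 / 2) * (1 + G₁)) * rename (Fin.natAdd N₁) (C (1 / 2) * (1 + G₂)) +
        (1 - rename (Fin.castAdd N₂) (C (1 / 2) * (1 + G₁))) *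
          (1 - rename (Fin.natAdd N₁) (C (1 / 2) * (1 + G₂)))) := by
  refine ⟨1, fun _ => C (1 / 2) * (rename (Fin.castAdd N₂) G₁ + rename (Fin.natAdd N₁) G₂),
    fun _ => C (1 / 2) * (rename (Fin.castAdd N₂) G₁ - rename (Fin.natAdd N₁) G₂), fun _ => ⟨?_, ?_⟩, fun w => ?_⟩
  · refine (totalDegree_mul _ _).trans ?_
    rw [totalDegree_C, zero_add]
    exact (totalDegree_add _ _).trans (max_le ((totalDegree_rename_le _ _).trans hd₁)
      ((totalDegree_rename_le _ _).trans hd₂))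
  · refine (totalDegree_mul _ _).trans ?_
    rw [totalDegree_C, zero_add]
    exact (totalDegree_sub _ _).trans (max_le ((totalDegree_rename_le _ _).trans hd₁)
      ((totalDegree_rename_le _ _).trans hd₂))
  · show evalBool (rename (Fin.castAdd N₂) (C (1 / 2) * (1 + G₁)) * rename (Fin.natAdd N₁) (C (1 / 2) * (1 + G₂)) +
        (1 - rename (Fin.castAdd N₂) (C (1 / 2) * (1 + G₁))) *
          (1 - rename (Fin.natAdd N₁) (C (1 / 2) * (1 + G₂)))) w =
        ∑ j : Fin 1, evalBool (C (1 / 2) * (rename (Fin.castAdd N₂) G₁ + rename (Fin.natAdd N₁) G₂)) w ^ 2 ∧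
      1 - evalBool (rename (Fin.castAdd N₂) (C (1 / 2) * (1 + G₁)) * rename (Fin.natAdd N₁) (C (1 / 2) * (1 + G₂)) +
        (1 - rename (Fin.castAdd N₂) (C (1 / 2) * (1 + G₁))) *
          (1 - rename (Fin.natAdd N₁) (C (1 / 2) * (1 + G₂)))) w =
        ∑ j : Fin 1, evalBool (C (1 / 2) * (rename (Fin.castAdd N₂) G₁ - rename (Fin.natAdd N₁) G₂)) w ^ 2
    rw [Fin.sum_univ_one, Fin.sum_univ_one, evalBool_xor, evalBool_half_one_add, evalBool_half_one_add,
      AddrWitness.evalBool_C_mul', AddrWitness.evalBool_add', AddrWitness.evalBool_C_mul', AddrWitness.evalBool_sub',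
      evalBool_rename_castAdd, evalBool_rename_natAdd]
    constructor
    · linear_combination (-1 / 4 : ℝ) * h₁ (w ∘ Fin.castAdd N₂) + (-1 / 4 : ℝ) * h₂ (w ∘ Fin.natAdd N₁)
    · linear_combination (-1 / 4 : ℝ) * h₁ (w ∘ Fin.castAdd N₂) + (-1 / 4 : ℝ) * h₂ (w ∘ Fin.natAdd N₁)

/-- Pointwise form: `h₁ ⊕ h₂ = (1 + G₁G₂)/2` on the two blocks. [folklore] -/
theorem evalBool_xor_half_one_add (G₁ : MvPolynomial (Fin N₁) ℝ) (G₂ : MvPolynomial (Fin N₂) ℝ)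
    (w : Fin (N₁ + N₂) → Bool) :
    evalBool (rename (Fin.castAdd N₂) (C (1 / 2) * (1 + G₁)) * rename (Fin.natAdd N₁) (C (1 / 2) * (1 + G₂)) +
        (1 - rename (Fin.castAdd N₂) (C (1 / 2) * (1 + G₁))) *
          (1 - rename (Fin.natAdd N₁) (C (1 / 2) * (1 + G₂)))) w =
      1 / 2 * (1 + evalBool G₁ (w ∘ Fin.castAdd N₂) * evalBool G₂ (w ∘ Fin.natAdd N₁)) := by
  rw [evalBool_xor, evalBool_half_one_add, evalBool_half_one_add]
  ring

/-- Influences of the XOR-square: a first-block variable has `Inf = Inf_i[h₁] = E (G₁ − G₁∘flipᵢ)²/4` when `G₂` is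
`±1`-valued and `E h₂ = 1/2` (`Var[h₂] = 1/4`). [folklore] -/
theorem influence_xor_half_one_add_castAdd (G₁ : MvPolynomial (Fin N₁) ℝ) {G₂ : MvPolynomial (Fin N₂) ℝ}
    (h₂ : ∀ y, evalBool G₂ y ^ 2 = 1) (hm₂ : boolAvg (evalBool (C (1 / 2) * (1 + G₂))) = 1 / 2) (i : Fin N₁) :
    influence (Fin.castAdd N₂ i)
      (rename (Fin.castAdd N₂) (C (1 / 2) * (1 + G₁)) * rename (Fin.natAdd N₁) (C (1 / 2) * (1 + G₂)) +
        (1 - rename (Fin.castAdd N₂) (C (1 / 2) * (1 + G₁))) *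
          (1 - rename (Fin.natAdd N₁) (C (1 / 2) * (1 + G₂)))) =
      influence i (C (1 / 2) * (1 + G₁)) := by
  rw [influence_xor_castAdd _ _ hm₂, boolVariance_half_one_add h₂ hm₂]
  ring

/-- Influences of the XOR-square, second block. [folklore] -/
theorem influence_xor_half_one_add_natAdd {G₁ : MvPolynomial (Fin N₁) ℝ} (G₂ : MvPolynomial (Fin N₂) ℝ)
    (h₁ : ∀ x, evalBool G₁ x ^ 2 = 1) (hm₁ : boolAvg (evalBool (C (1 / 2) * (1 + G₁))) = 1 / 2) (j : Fin N₂) :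
    influence (Fin.natAdd N₁ j)
      (rename (Fin.castAdd N₂) (C (1 / 2) * (1 + G₁)) * rename (Fin.natAdd N₁) (C (1 / 2) * (1 + G₂)) +
        (1 - rename (Fin.castAdd N₂) (C (1 / 2) * (1 + G₁))) *
          (1 - rename (Fin.natAdd N₁) (C (1 / 2) * (1 + G₂)))) =
      influence j (C (1 / 2) * (1 + G₂)) := by
  rw [influence_xor_natAdd _ _ hm₁, boolVariance_half_one_add h₁ hm₁]
  ring

end Summit.QuantumAdvantage.QuantumAdvantage.Theorems.SosSandwich

end
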